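import Mathlib
import Literature.Computability.Complexity.RossmanMonotoneCliqueRelative
import Literature.Computability.Complexity.GnpSprinkling
import HarnessLib

/-!
# Route NegLimited — ladder support `LadderAdvantage` (line `density-ladder`, stub 2; rung F-N1/p3, ROUND-9 §B)

Registered stub `stub_ladderAdvantage` of the skeleton `density-ladder`
(HOME/pnp-ideate-p3/r9/ladder/density-ladder.lean, sha 2d55ebf8) on the support item
`NegLimited.NeglimitedLogOverOmegaNegations` (stmt-PneNP-19555): the ENGINE COROLLARY of the line.
Along the density ladder `p_j = 1 - (1 - p⁻)^j` (`p⁻ = pMinus k δ n = n^{-2(1+δ)/(k-1)}`) the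
planted-clique flip probabilities of a small monotone circuit `g` (over `{∧₂, ∨₂, 0, 1}`,
`size g + 1 ≤ n^{k/4}`) sum to at most `(T+1)(η + e^{-n^{c'}}) + 1`.

Proof (all ingredients PROVED in the tree):
* for a MONOTONE `f` a planted pair `(x, x ∪ K_A)` is a flip iff `f x = 0 ∧ f (x ∪ K_A) = 1`, so
  `plantFlipProb n k q f = E_{x ∼ G(n,q)} Pr_A[f(x ∪ K_A) = 1] - Pr[f(G(n,q)) = 1]`
  (`plantFlipProb_eq_of_monotone`; `plantClique_eq_sup`, `k ≤ n`);
* Rossman 2010 Thm 1 relative to a random background, averaged (`rsd_at_admissible_dose`, at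
  `c₀ := 0`, `q := p_j`): `E_x Pr_A[g(x ∪ K_A)] ≤ η + e^{-n^{c'}} + E_x E_{y ∼ G(n,p⁻)} g(x ∪ y)`;
* the union law (`sum_sum_gnpWeight_ite_sup`): `G(n,q) ∪ G(n,p⁻) ∼ G(n, q + p⁻ - q p⁻)` EXACTLY, and
  `p_j + p⁻ - p_j p⁻ = p_{j+1}`; hence `plantFlipProb(p_j, g) ≤ η + e^{-n^{c'}} + φ(p_{j+1}) - φ(p_j)`
  with `φ(p) = Pr[g(G(n,p)) = 1] ∈ [0, 1]` (`plantFlipProb_rung_le`);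
* telescoping over `j = 0, …, T` (`Finset.sum_range_sub`) and `φ ≤ 1`, `0 ≤ φ` (`gnpProb_le_one`,
  `gnpProb_nonneg`).
-/

set_option linter.dupNamespace false -- `Summit.PneNP.PneNP.…`: summit = sub-problem name (D-0017 single-conjunct layout)

namespace Summit.PneNP.PneNP.Theorems.NegLimitedLadder

open Finset Filter
open Literature.Computability.Complexity

/-- The stub statement `LadderAdvantage` (verbatim from the registered skeleton `density-ladder`): along
the density ladder `p_j = 1 - (1 - p⁻)^j` the planted-clique flip probabilities of a small monotone
circuit sum to at most `(T+1)(η + e^{-n^{c'}}) + 1`. -/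
def LadderAdvantage : Prop :=
  ∀ (n k : ℕ), 5 ≤ k → ∀ δ : ℝ, 0 < δ → δ ≤ 1 / (k : ℝ) ^ 3 → ∀ η : ℝ, 0 < η →
    LargeN k δ 1 η n →
    ∀ g : Literature.Computability.Complexity.Circuit ↥(⊤ : SimpleGraph (Fin n)).edgeSet,
      g.IsOver monotoneBasis01 → (g.size : ℝ) + 1 ≤ (n : ℝ) ^ ((k : ℝ) / 4) →
      ∀ T : ℕ, ∑ j ∈ range (T + 1), plantFlipProb n k (1 - (1 - pMinus k δ n) ^ j) g.eval ≤
        ((T : ℝ) + 1) * (η + Real.exp (-((n : ℝ) ^ cPrime k δ))) + 1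

/-! ### Monotone flips are differences of acceptance probabilities -/

/-- For a MONOTONE `f` and `k ≤ n`:
`plantFlipProb n k q f = E_{x ∼ G(n,q)} Pr_A[f(x ∪ K_A) = 1] - Pr[f(G(n,q)) = 1]`
(a planted pair `x ≤ x ∪ K_A` flips `f` iff `f x = 0` and `f (x ∪ K_A) = 1`). A polynomial identity in
`q`. -/
theorem plantFlipProb_eq_of_monotone {n k : ℕ} (hkn : k ≤ n) (q : ℝ)
    {f : ((⊤ : SimpleGraph (Fin n)).edgeSet → Bool) → Bool} (hf : Monotone f) :
    plantFlipProb n k q f =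
      (∑ x : (⊤ : SimpleGraph (Fin n)).edgeSet → Bool, gnpWeight n q x *
          kSubsetProb n k (fun A => f (x ⊔ cliqueVec A) = true)) -
        gnpProb n q (univ.filter fun x => f x = true) := by
  classical
  have hN : (0 : ℝ) < (n.choose k : ℝ) := by exact_mod_cast Nat.choose_pos hkn
  -- pointwise identity of the indicators
  have hpt : ∀ (A : Finset (Fin n)) (x : (⊤ : SimpleGraph (Fin n)).edgeSet → Bool),
      (if f x = f (plantClique A x) then (0 : ℝ) else gnpWeight n q x) =
        gnpWeight n q x * (if f (x ⊔ cliqueVec A) = true then 1 else 0) -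
          gnpWeight n q x * (if f x = true then 1 else 0) := by
    intro A x
    have hle : f x ≤ f (x ⊔ cliqueVec A) := hf le_sup_left
    rw [plantClique_eq_sup]
    cases hx : f x <;> cases hy : f (x ⊔ cliqueVec A)
    · simp
    · simp
    · rw [hx, hy] at hle
      exact absurd hle (by decide)
    · simp
  unfold plantFlipProb
  simp_rw [hpt, sum_sub_distrib]
  rw [mul_sub]
  congr 1
  · -- `C(n,k)⁻¹ Σ_A Σ_x w(x) [f(x ∪ K_A)] = Σ_x w(x) Pr_A[f(x ∪ K_A)]`
    rw [sum_comm, mul_sum]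
    refine sum_congr rfl fun x _ => ?_
    rw [kSubsetProb, natCast_card_filter, ← mul_sum, div_eq_mul_inv]
    ring
  · -- `C(n,k)⁻¹ Σ_A Σ_x w(x) [f x] = Pr[f(G(n,q)) = 1]`
    rw [sum_const, card_powersetCard, card_univ, Fintype.card_fin, nsmul_eq_mul, ← mul_assoc,
      inv_mul_cancel₀ hN.ne', one_mul, gnpProb_filter]
    refine sum_congr rfl fun x _ => ?_
    split_ifs <;> simp

/-! ### One rung: Theorem 1 relative + the union law -/

/-- **One rung of the ladder.** For `0 ≤ q ≤ 1`, `LargeN k δ 1 η n` and a circuit `g` over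
`{∧₂, ∨₂, 0, 1}` with `size g + 1 ≤ n^{k/4}`:
`plantFlipProb n k q g ≤ η + e^{-n^{c'}} + Pr[g(G(n, q ⊕ p⁻)) = 1] - Pr[g(G(n, q)) = 1]`,
`q ⊕ p⁻ = q + p⁻ - q p⁻` (`rsd_at_admissible_dose` at `c₀ = 0` + `sum_sum_gnpWeight_ite_sup`). -/
theorem plantFlipProb_rung_le {n k : ℕ} (hk : 5 ≤ k) {δ : ℝ} (hδ0 : 0 < δ)
    (hδ1 : δ ≤ 1 / (k : ℝ) ^ 3) {η q : ℝ} (hη : 0 < η) (hq0 : 0 ≤ q) (hq1 : q ≤ 1)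
    (hn : LargeN k δ 1 η n) (g : Circuit ((⊤ : SimpleGraph (Fin n)).edgeSet))
    (hg : g.IsOver monotoneBasis01) (hsize : (g.size : ℝ) + 1 ≤ (n : ℝ) ^ ((k : ℝ) / 4)) :
    plantFlipProb n k q g.eval ≤
      η + Real.exp (-((n : ℝ) ^ cPrime k δ)) +
        (gnpProb n (q + pMinus k δ n - q * pMinus k δ n) (univ.filter fun x => g.eval x = true) -
          gnpProb n q (univ.filter fun x => g.eval x = true)) := by
  classical
  have hn' : LargeN k δ (0 + 1) η n := by rw [zero_add]; exact hn
  have hsize' : (g.size : ℝ) + 1 ≤ (0 + 1) * (n : ℝ) ^ ((k : ℝ) / 4) := by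
    rw [zero_add, one_mul]; exact hsize
  have hrsd := rsd_at_admissible_dose hk hδ0 hδ1 hη hq0 hq1 hn' g hg hsize'
  rw [sum_sum_gnpWeight_ite_sup q (pMinus k δ n) (fun z => g.eval z = true)] at hrsd
  rw [plantFlipProb_eq_of_monotone hn.hkn q (g.monotone_eval_of_isOver_monotoneBasis01 hg)]
  linarith

/-! ### The stub -/

/-- **Stub 2 of line `density-ladder` PROVED** (`LadderAdvantage`, by name): sum the rungs
`plantFlipProb(p_j) ≤ η + e^{-n^{c'}} + φ(p_{j+1}) - φ(p_j)` over `j ≤ T` and telescope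
(`φ ∈ [0,1]`). -/
theorem stub_ladderAdvantage : LadderAdvantage := by
  intro n k hk δ hδ0 hδ1 η hη hn g hg hsize T
  classical
  set p := pMinus k δ n with hp
  set E := η + Real.exp (-((n : ℝ) ^ cPrime k δ)) with hE
  set φ : ℕ → ℝ := fun j => gnpProb n (1 - (1 - p) ^ j) (univ.filter fun x => g.eval x = true)
    with hφ
  have hp0 : 0 ≤ p := Real.rpow_nonneg (Nat.cast_nonneg n) _
  have hp1 : p ≤ 1 := by have := hn.hp; rw [← hp] at this; linarith
  have h1p0 : 0 ≤ 1 - p := by linarith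
  have h1p1 : 1 - p ≤ 1 := by linarith
  have hP0 : ∀ j : ℕ, 0 ≤ 1 - (1 - p) ^ j := fun j => by
    have := pow_le_one₀ h1p0 h1p1 (n := j); linarith
  have hP1 : ∀ j : ℕ, 1 - (1 - p) ^ j ≤ 1 := fun j => by
    have := pow_nonneg h1p0 j; linarith
  -- one rung, with the ladder identity `p_j ⊕ p⁻ = p_{j+1}`
  have hrung : ∀ j : ℕ, plantFlipProb n k (1 - (1 - p) ^ j) g.eval ≤ E + (φ (j + 1) - φ j) := by
    intro j
    have h := plantFlipProb_rung_le hk hδ0 hδ1 hη (hP0 j) (hP1 j) hn g hg hsize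
    have hlad : 1 - (1 - p) ^ j + pMinus k δ n - (1 - (1 - p) ^ j) * pMinus k δ n =
        1 - (1 - p) ^ (j + 1) := by rw [← hp]; ring
    rw [hlad] at h
    exact h
  -- sum and telescope
  have hφ0 : 0 ≤ φ 0 := gnpProb_nonneg (hP0 0) (hP1 0) _
  have hφT : φ (T + 1) ≤ 1 := gnpProb_le_one (hP0 (T + 1)) (hP1 (T + 1)) _
  calc ∑ j ∈ range (T + 1), plantFlipProb n k (1 - (1 - p) ^ j) g.eval
      ≤ ∑ j ∈ range (T + 1), (E + (φ (j + 1) - φ j)) := sum_le_sum fun j _ => hrung j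
    _ = ((T : ℝ) + 1) * E + (φ (T + 1) - φ 0) := by
        rw [sum_add_distrib, sum_const, card_range, nsmul_eq_mul, sum_range_sub]
        push_cast
        ring
    _ ≤ ((T : ℝ) + 1) * E + 1 := by linarith

end Summit.PneNP.PneNP.Theorems.NegLimitedLadder
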